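import Literature.MathematicalPhysics.QuantumLattice.HubbardCTScaleZeroDetBound
import HarnessLib

/-!
# The determinant bound for a WEIGHTED normal covariance of the Hubbard torus on the `4M` time grid, uniformly in the
# Matsubara cutoff (de Siqueira Pedra–Salmhofer 2008, Thm 1.3 / 2.4) — any weight `v ≤ 1`

Topic `MathematicalPhysics/QuantumLattice`; the generic form of `HubbardCTScaleZeroDetBound.isDetBoundedR_gridSub_hubbardCovAboveCT`
(cell gate-hubbard-kl, crux K3, engine item `KLRegimeEngineV16`, stub `stub_twoLeg_scale0`, cutoff leg of (E3f-AT)₀).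

There the scale-`0` covariance `C^K_{>Λ}` of the counterterm carrier — the normal covariance of the `2M`-frequency algebra with symbol
`w^K_Λ(k)·βL²·(iω + e_K)/(ω² + e_K²)`, `w^K_Λ = χ₂((ω² + e_K²)/Λ²) ∈ [0,1]` — was shown to be determinant-bounded on the `N = 4M` time grid
with the `M`-uniform constant `√(2(7 + κ²))`, `κ² ≥ (βL²)⁻¹Σ (1 − w)/√(ω² + e_K²)`, by instantiating
`MatsubaraTruncationGridGram.norm_det_truncatedPropagator_grid_add_symbol_le` (the sharply truncated propagator on the grid twice as
fine as the frequency set = chronological kernel + uniformly small Gram kernel; Pedra–Salmhofer Thm 1.3) with the extra symbol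
`r = −(1 − w)/(−iω + e_K)`.  That proof reads only two properties of the weight: `w ≤ 1` and the bound `κ²`.  Here it is re-run for an

* ARBITRARY real weight `v : FreqMomentum L M → ℝ` with `v ≤ 1` pointwise (no lower bound, no cutoff function):
  **`isDetBoundedR_gridSub_normalCovariance_weighted`** — for `0 < β`, `0 < M`, a frame `K`, `μ`, and any `κ` with
  `(βL²)⁻¹ Σ_{(i,k⃗)} (1 − v(i,k⃗))/√(ν_i² + e_K(k⃗)²) ≤ κ²`, the pulled-back covariance
  `Sᵀ · normalCovariance L M (v·βL²(iω + e_K)/(ω² + e_K²)) · S` (`S = hubbardGridSub L M β (4M)`, charge-`0` legs as rows) satisfies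
  `IsDetBoundedR q (…) √(2(7 + κ²))`;
* `isGramBoundedR_gridSub_normalCovariance_weighted` — hence replica-Gram-bounded with the same constant (`IsDetBoundedR.isGramBoundedR`
  and the `U(1)` selection rule of the pulled-back normal covariance).

Use (the two-cutoff comparison `M ≤ M″ ≤ 2M` of the KL programme, companion file `HubbardMatsubaraTwoCutoffGram`): on the common
`4M″` grid the INTERPOLATED covariance `C_g + t·S_g` (`C_g` = the cutoff-`M` covariance, `S_g` = the shell covariance, `t ∈ [0,1]`) is the
pulled-back normal covariance of the `M″`-algebra with weight `v_t = [window]·w^K_Λ + t·[shell]`, so this file bounds its determinants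
uniformly in `t`, `M`, `M″` — the covariance input of the Gram-bounded truncation theorems along the interpolation, with no Gram FORM of
`C_g` needed.  Everything is PROVED; no definitions, no named facts.

## Sources

W. de Siqueira Pedra, M. Salmhofer, Comm. Math. Phys. 282 (2008) 797–818, Thm 1.3, Thm 2.4, Lemma 5.1 [`PedraSalmhofer2008`];
G. Benfatto, A. Giuliani, V. Mastropietro, Ann. Henri Poincaré 7 (2006) 809–898, §2.8 (2.80) [`BenfattoGiulianiMastropietro2006`].
-/

noncomputable section

open Finset

open scoped InnerProductSpace ComplexConjugate

namespace Literature.MathematicalPhysics.QuantumLattice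

open Literature.Probability.LatticeModels GrassmannAlgebra

section Aux

/-- For an antisymmetric covariance the two-point function is `-C(X, Y)`. [folklore] -/
private theorem contr_apply_of_transpose_eq_neg_w {Γ : Type*} {A : Matrix Γ Γ ℂ} (h : A.transpose = -A) (X Y : Γ) :
    contr ℂ A X Y = -A X Y := by
  have h1 : A Y X = -A X Y := by
    have := congrFun (congrFun h X) Y
    rwa [Matrix.transpose_apply, Matrix.neg_apply] at this
  rw [contr_apply, h1, Rat.smul_one_eq_cast]
  push_cast
  ring

/-- `(iν + ξ)/(ν² + ξ²) = 1/(-iν + ξ)` for a nonzero real frequency. [folklore] -/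
private theorem I_mul_add_div_eq_inv_w {ν ξ : ℝ} (hν : ν ≠ 0) :
    (Complex.I * ν + ξ) / ((ν ^ 2 + ξ ^ 2 : ℝ) : ℂ) = 1 / (-(ν : ℂ) * Complex.I + ξ) := by
  have hden : (-(ν : ℂ) * Complex.I + ξ) ≠ 0 := by
    intro h
    have := congrArg Complex.im h
    simp at this
    exact hν (by linarith)
  have hden2 : ((ν ^ 2 + ξ ^ 2 : ℝ) : ℂ) ≠ 0 := by
    have : 0 < ν ^ 2 + ξ ^ 2 := by positivity
    exact_mod_cast this.ne'
  rw [div_eq_div_iff hden2 hden, one_mul]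
  push_cast
  ring_nf
  rw [Complex.I_sq]
  ring

/-- The modulus of `-iν + ξ` is `√(ν² + ξ²)`. [folklore] -/
private theorem norm_neg_I_add_w (ν ξ : ℝ) : ‖-(ν : ℂ) * Complex.I + ξ‖ = Real.sqrt (ν ^ 2 + ξ ^ 2) := by
  rw [Complex.norm_def, Complex.normSq_apply]
  congr 1
  simp
  ring

/-- Equal charge flags mean equal charges. [folklore] -/
private theorem charge_eq_of_decide_eq_w {P : Type*} {X Y : GridLeg P} (hq : decide (X.2 = 0) = decide (Y.2 = 0)) : X.2 = Y.2 := by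
  rcases Fin.exists_fin_two.1 ⟨X.2, rfl⟩ with hX | hX <;> rcases Fin.exists_fin_two.1 ⟨Y.2, rfl⟩ with hY | hY <;> simp_all

end Aux

/-! ### The determinant bound for an arbitrary weight `v ≤ 1` -/

section Main

variable {L M : ℕ} [NeZero L]

/-- **A weighted normal covariance on the `4M` grid is determinant-bounded, uniformly in `M`** (the generic form of
`isDetBoundedR_gridSub_hubbardCovAboveCT`): for `0 < β`, `0 < M`, a frame `K`, `μ`, ANY real weight `v ≤ 1` on the field labels and any
`κ` with `(βL²)⁻¹ Σ_{(i,k⃗)} (1 − v(i,k⃗))/√(ν_i² + e_K(k⃗)²) ≤ κ²`, the pulled-back covariance of the grid fields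
(`S = hubbardGridSub L M β (4M)`, charge-`0` legs as rows) of the normal covariance with symbol `v·βL²·(iω + e_K)/(ω² + e_K²)` satisfies
`IsDetBoundedR q (Sᵀ C_v S) √(2(7 + κ²))`, i.e. `|det [⟨u_i,u'_j⟩ contr(X̄_i, Y_j)]| ≤ (2(7 + κ²))^a` for all Gram weights of norm `≤ 1`;
no `log M`.  (Pedra–Salmhofer's grid-chronological bound with the extra symbol `r = −(1 − v)/(−iω + e_K)`.) [cite: PedraSalmhofer2008, Thm 1.3] -/
theorem isDetBoundedR_gridSub_normalCovariance_weighted {β : ℝ} (hβ : 0 < β) (μ : ℝ) (K : TrigPolyC4v) [NeZero M]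
    (v : FreqMomentum L M → ℝ) (hv1 : ∀ k, v k ≤ 1) {κ : ℝ}
    (hIR : 1 / (β * (L : ℝ) ^ 2) * ∑ k : FreqMomentum L M,
        (1 - v k) / Real.sqrt (matsubaraFreq β M k.1 ^ 2 + nambuXiCT L μ K k.2 ^ 2) ≤ κ ^ 2) :
    IsDetBoundedR (fun X : GridLeg (GridPoint L (2 * (2 * M))) => decide (X.2 = 0))
      ((hubbardGridSub L M β (2 * (2 * M))).transpose *
        normalCovariance L M (fun ks => (v ks.1 : ℂ) *
          (((β * (L : ℝ) ^ 2 : ℝ) : ℂ) *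
            ((Complex.I * matsubaraFreq β M ks.1.1 + nambuXiCT L μ K ks.1.2) / nambuDenCT L M β μ 0 K ks.1))) *
        hubbardGridSub L M β (2 * (2 * M)))
      (Real.sqrt (2 * (7 + κ ^ 2))) := by
  intro n a u u' hu hu' Xb Xu hb hub
  have hXb : ∀ i, (Xb i).2 = 0 := fun i => of_decide_eq_true (hb i)
  have hXu : ∀ j, (Xu j).2 = 1 := fun j => Fin.eq_one_of_ne_zero _ (of_decide_eq_false (hub j))
  have hL : (0 : ℝ) < L := by exact_mod_cast Nat.pos_of_ne_zero (NeZero.ne L)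
  have hLc : (L : ℂ) ≠ 0 := by exact_mod_cast hL.ne'
  have hβc : (β : ℂ) ≠ 0 := by exact_mod_cast hβ.ne'
  have hβL : (0 : ℝ) < β * (L : ℝ) ^ 2 := by positivity
  simp only [hubbardGridSub]
  -- the weighted symbol
  set p : FreqMomentum L M × Fin 2 → ℂ := fun ks => (v ks.1 : ℂ) *
    (((β * (L : ℝ) ^ 2 : ℝ) : ℂ) *
      ((Complex.I * matsubaraFreq β M ks.1.1 + nambuXiCT L μ K ks.1.2) / nambuDenCT L M β μ 0 K ks.1)) with hp
  -- the data in the form of `norm_det_truncatedPropagator_grid_add_symbol_le` (its rows = our charge-`1` columns)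
  set ξ : (TorusSite 2 L × Fin 2) × Fin n → ℝ := fun m => nambuXiCT L μ K m.1.1 with hξ
  set r0 : TorusSite 2 L → MatsubaraIdx M → ℂ := fun kv i' =>
    ((v (i', kv) : ℂ) - 1) / (-((matsubaraFreq β M i' : ℝ) : ℂ) * Complex.I + (nambuXiCT L μ K kv : ℂ)) with hr0
  set r : (TorusSite 2 L × Fin 2) × Fin n → MatsubaraIdx M → ℂ := fun m i' => r0 m.1.1 i' with hr
  set ea : Fin a → TorusSite 2 L → ℂ := fun j kv => ((1 / (L : ℝ) : ℝ) : ℂ) *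
    Complex.exp (-(((∑ l, latticeMomentum L kv l * (((Xu j).1.1.2 l).val : ℝ) : ℝ) : ℂ) * Complex.I)) with hea
  set eb : Fin a → TorusSite 2 L → ℂ := fun i kv => ((1 / (L : ℝ) : ℝ) : ℂ) *
    Complex.exp (((∑ l, latticeMomentum L kv l * (((Xb i).1.1.2 l).val : ℝ) : ℝ) : ℂ) * Complex.I) with heb
  set Ff : Fin a → (TorusSite 2 L × Fin 2) × Fin n → ℂ := fun j m =>
    -(1 * ((if m.1.2 = (Xu j).1.2 then 1 else 0) * ea j m.1.1) * ((u' j m.2 : ℝ) : ℂ)) with hFf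
  set Gf : Fin a → (TorusSite 2 L × Fin 2) × Fin n → ℂ := fun i m =>
    ((if m.1.2 = (Xb i).1.2 then 1 else 0) * eb i m.1.1) * ((u i m.2 : ℝ) : ℂ) with hGf
  set Kt : Fin a → Fin a → TorusSite 2 L → ℂ := fun j i kv =>
    ((1 / β : ℝ) : ℂ) * ∑ i' : MatsubaraIdx M,
      Complex.exp (-((matsubaraFreq β M i' *
        (gridTime β (2 * (2 * M)) (Xu j).1.1.1 - gridTime β (2 * (2 * M)) (Xb i).1.1.1) : ℝ) : ℂ) * Complex.I) *
        (1 / (-((matsubaraFreq β M i' : ℝ) : ℂ) * Complex.I + (nambuXiCT L μ K kv : ℂ)) + r0 kv i') with hKt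
  -- (1) the symbol identity `1/(-iν+ξ) + r = v/(-iν+ξ)`
  have hνne : ∀ i' : MatsubaraIdx M, matsubaraFreq β M i' ≠ 0 := fun i' => matsubaraFreq_ne_zero hβ.ne' i'
  have hden : ∀ (i' : MatsubaraIdx M) (kv : TorusSite 2 L),
      (-((matsubaraFreq β M i' : ℝ) : ℂ) * Complex.I + (nambuXiCT L μ K kv : ℂ)) ≠ 0 := by
    intro i' kv h
    have := congrArg Complex.im h
    simp at this
    exact hνne i' (by linarith)
  have hsym : ∀ (i' : MatsubaraIdx M) (kv : TorusSite 2 L),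
      1 / (-((matsubaraFreq β M i' : ℝ) : ℂ) * Complex.I + (nambuXiCT L μ K kv : ℂ)) + r0 kv i' =
        (v (i', kv) : ℂ) / (-((matsubaraFreq β M i' : ℝ) : ℂ) * Complex.I + (nambuXiCT L μ K kv : ℂ)) := by
    intro i' kv
    simp only [hr0]
    have hd := hden i' kv
    field_simp
    ring
  have hpsym : ∀ (i' : MatsubaraIdx M) (kv : TorusSite 2 L) (s : Fin 2),
      p ((i', kv), s) = ((β * (L : ℝ) ^ 2 : ℝ) : ℂ) *
        ((v (i', kv) : ℂ) / (-((matsubaraFreq β M i' : ℝ) : ℂ) * Complex.I + (nambuXiCT L μ K kv : ℂ))) := by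
    intro i' kv s
    simp only [hp]
    have hd : nambuDenCT L M β μ 0 K (i', kv) = matsubaraFreq β M i' ^ 2 + nambuXiCT L μ K kv ^ 2 := by
      simp [nambuDenCT]
    rw [hd, I_mul_add_div_eq_inv_w (hνne i')]
    ring
  -- the entry of the pulled-back covariance, charge-0 row `i`, charge-1 column `j`
  have hentry0 : ∀ i j,
      ((gridSubMatrix L M β (fun q : GridPoint L (2 * (2 * M)) => q.2) (fun q => gridTime β (2 * (2 * M)) q.1)).transpose *
          normalCovariance L M p *
          gridSubMatrix L M β (fun q : GridPoint L (2 * (2 * M)) => q.2) (fun q => gridTime β (2 * (2 * M)) q.1)) (Xb i) (Xu j) =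
        if (Xb i).1.2 = (Xu j).1.2 then ∑ k : FreqMomentum L M, ((1 / (β * (L : ℝ) ^ 2) : ℝ) : ℂ) ^ 2 *
          (Complex.exp (((vertexPhase L M β k (Xb i).1.1.2 (gridTime β (2 * (2 * M)) (Xb i).1.1.1) -
              vertexPhase L M β k (Xu j).1.1.2 (gridTime β (2 * (2 * M)) (Xu j).1.1.1) : ℝ) : ℂ) * Complex.I) * p (k, (Xb i).1.2))
        else 0 := by
    intro i j
    have hXbeq : Xb i = (((Xb i).1.1, (Xb i).1.2), 0) := by rw [← hXb i]
    have hXueq : Xu j = (((Xu j).1.1, (Xu j).1.2), 1) := by rw [← hXu j]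
    conv_lhs => rw [hXbeq, hXueq]
    exact gridSub_pullback_normalCovariance_apply_zero_one β _ _ p (Xb i).1.1 (Xu j).1.1 (Xb i).1.2 (Xu j).1.2
  -- (2) `E i j = T j i`
  have hT : ∀ i j, ((⟪u i, u' j⟫_ℝ : ℝ) : ℂ) *
      contr ℂ ((gridSubMatrix L M β (fun q : GridPoint L (2 * (2 * M)) => q.2) (fun q => gridTime β (2 * (2 * M)) q.1)).transpose *
        normalCovariance L M p *
        gridSubMatrix L M β (fun q : GridPoint L (2 * (2 * M)) => q.2) (fun q => gridTime β (2 * (2 * M)) q.1)) (Xb i) (Xu j) =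
      ∑ m, Ff j m * Gf i m * Kt j i m.1.1 := by
    intro i j
    rw [contr_apply_of_transpose_eq_neg_w (gridSub_pullback_normalCovariance_transpose β _ _ p) (Xb i) (Xu j), hentry0]
    have hmode := sum_frozen_modes_eq (L := L) (n := n) 1 (Xu j).1.2 (Xb i).1.2 (ea j) (eb i) (Kt j i) (u' j) (u i)
    simp only [hFf, hGf]
    rw [hmode, one_mul, real_inner_comm (u i) (u' j)]
    by_cases hσ : (Xb i).1.2 = (Xu j).1.2
    · rw [if_pos hσ, if_pos hσ.symm, one_mul]
      have hsum : ∑ k : FreqMomentum L M, ((1 / (β * (L : ℝ) ^ 2) : ℝ) : ℂ) ^ 2 *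
          (Complex.exp (((vertexPhase L M β k (Xb i).1.1.2 (gridTime β (2 * (2 * M)) (Xb i).1.1.1) -
              vertexPhase L M β k (Xu j).1.1.2 (gridTime β (2 * (2 * M)) (Xu j).1.1.1) : ℝ) : ℂ) * Complex.I) *
            p (k, (Xb i).1.2)) =
          ∑ kv, ea j kv * eb i kv * Kt j i kv := by
        rw [Fintype.sum_prod_type, sum_comm]
        refine sum_congr rfl fun kv _ => ?_
        simp only [hKt]
        rw [mul_sum, mul_sum]
        refine sum_congr rfl fun i' _ => ?_
        rw [hsym, hpsym]
        have hexp : Complex.exp (((vertexPhase L M β (i', kv) (Xb i).1.1.2 (gridTime β (2 * (2 * M)) (Xb i).1.1.1) -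
            vertexPhase L M β (i', kv) (Xu j).1.1.2 (gridTime β (2 * (2 * M)) (Xu j).1.1.1) : ℝ) : ℂ) * Complex.I) =
            Complex.exp (-(((∑ l, latticeMomentum L kv l * (((Xu j).1.1.2 l).val : ℝ) : ℝ) : ℂ) * Complex.I)) *
              Complex.exp (((∑ l, latticeMomentum L kv l * (((Xb i).1.1.2 l).val : ℝ) : ℝ) : ℂ) * Complex.I) *
              Complex.exp (-((matsubaraFreq β M i' *
                (gridTime β (2 * (2 * M)) (Xu j).1.1.1 - gridTime β (2 * (2 * M)) (Xb i).1.1.1) : ℝ) : ℂ) * Complex.I) := by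
          rw [← Complex.exp_add, ← Complex.exp_add]
          congr 1
          simp only [vertexPhase]
          push_cast
          ring
        rw [hexp]
        simp only [hea, heb]
        have hd := hden i' kv
        push_cast
        field_simp
      rw [hsum]
      ring
    · rw [if_neg hσ, if_neg (fun h => hσ h.symm)]
      simp
  -- (3) the matrix is the transpose of the grid-chronological form
  set T : Matrix (Fin a) (Fin a) ℂ := Matrix.of fun a' b' : Fin a => ∑ m, Ff a' m * Gf b' m *
    (((1 / β : ℝ) : ℂ) * ∑ i' : MatsubaraIdx M,
      Complex.exp (-((matsubaraFreq β M i' *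
        (gridTime β (2 * (2 * M)) ((fun a' => (Xu a').1.1.1) a') - gridTime β (2 * (2 * M)) ((fun b' => (Xb b').1.1.1) b')) :
          ℝ) : ℂ) * Complex.I) *
          (1 / (-((matsubaraFreq β M i' : ℝ) : ℂ) * Complex.I + (ξ m : ℂ)) + r m i')) with hTdef
  have hmat : (Matrix.of fun i j : Fin a => ((⟪u i, u' j⟫_ℝ : ℝ) : ℂ) *
      contr ℂ ((gridSubMatrix L M β (fun q : GridPoint L (2 * (2 * M)) => q.2) (fun q => gridTime β (2 * (2 * M)) q.1)).transpose *
        normalCovariance L M p *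
        gridSubMatrix L M β (fun q : GridPoint L (2 * (2 * M)) => q.2) (fun q => gridTime β (2 * (2 * M)) q.1)) (Xb i) (Xu j)) =
      T.transpose := by
    ext i j
    rw [Matrix.transpose_apply, Matrix.of_apply, hT i j, hTdef, Matrix.of_apply]
  -- (4) the row weights
  have hnormr : ∀ (kv : TorusSite 2 L) (i' : MatsubaraIdx M),
      ‖r0 kv i'‖ = (1 - v (i', kv)) / Real.sqrt (matsubaraFreq β M i' ^ 2 + nambuXiCT L μ K kv ^ 2) := by
    intro kv i'
    simp only [hr0]
    rw [norm_div, show ((v (i', kv) : ℂ) - 1) = ((v (i', kv) - 1 : ℝ) : ℂ) by push_cast; ring, Complex.norm_real,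
      Real.norm_eq_abs, abs_of_nonpos (by linarith [hv1 (i', kv)]), neg_sub, norm_neg_I_add_w]
  set Wk : TorusSite 2 L → ℝ := fun kv => 7 + 1 / β * ∑ i', (1 - v (i', kv)) /
    Real.sqrt (matsubaraFreq β M i' ^ 2 + nambuXiCT L μ K kv ^ 2) with hWk
  have hWdef : ∀ m : (TorusSite 2 L × Fin 2) × Fin n, 7 + 1 / β * ∑ i', ‖r m i'‖ = Wk m.1.1 := by
    intro m
    simp only [hWk, hr, hnormr]
  have hWk0 : ∀ kv, 0 ≤ Wk kv := fun kv => by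
    simp only [hWk]
    exact add_nonneg (by norm_num) (mul_nonneg (by positivity) (sum_nonneg fun i' _ =>
      div_nonneg (by linarith [hv1 (i', kv)]) (Real.sqrt_nonneg _)))
  have hWsum : (1 / (L : ℝ) ^ 2) * ∑ kv, Wk kv ≤ 7 + κ ^ 2 := by
    have hsplit : (1 / (L : ℝ) ^ 2) * ∑ kv, Wk kv = 7 + 1 / (β * (L : ℝ) ^ 2) * ∑ k : FreqMomentum L M,
        (1 - v k) / Real.sqrt (matsubaraFreq β M k.1 ^ 2 + nambuXiCT L μ K k.2 ^ 2) := by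
      simp only [hWk]
      rw [sum_add_distrib, sum_const, card_univ, ← mul_sum, Fintype.sum_prod_type, sum_comm]
      have hcard : (Fintype.card (TorusSite 2 L) : ℝ) = (L : ℝ) ^ 2 := by
        rw [Fintype.card_pi, Fin.prod_const, ZMod.card]
        push_cast
        ring
      rw [nsmul_eq_mul, hcard]
      field_simp
    rw [hsplit]
    linarith
  have hFrow : ∀ j, ∑ m, ‖Ff j m‖ ^ 2 * (7 + 1 / β * ∑ i', ‖r m i'‖) ≤ 7 + κ ^ 2 := by
    intro j
    simp only [hWdef, hFf, norm_neg, one_mul]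
    rw [sum_norm_sq_mode_mul_weight_eq (Xu j).1.2 (ea j) (fun kv => ?_) (u' j) Wk]
    · have hu2 : ‖u' j‖ ^ 2 ≤ 1 := pow_le_one₀ (norm_nonneg _) (hu' j)
      calc ‖u' j‖ ^ 2 * ((1 / (L : ℝ) ^ 2) * ∑ kv, Wk kv) ≤ 1 * (7 + κ ^ 2) :=
            mul_le_mul hu2 hWsum (mul_nonneg (by positivity) (sum_nonneg fun kv _ => hWk0 kv)) zero_le_one
        _ = 7 + κ ^ 2 := one_mul _
    · simp only [hea]
      rw [norm_mul, Complex.norm_exp, Complex.norm_real, Real.norm_eq_abs]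
      simp
  have hGrow : ∀ i, ∑ m, ‖Gf i m‖ ^ 2 * (7 + 1 / β * ∑ i', ‖r m i'‖) ≤ 7 + κ ^ 2 := by
    intro i
    simp only [hWdef, hGf]
    rw [sum_norm_sq_mode_mul_weight_eq (Xb i).1.2 (eb i) (fun kv => ?_) (u i) Wk]
    · have hu2 : ‖u i‖ ^ 2 ≤ 1 := pow_le_one₀ (norm_nonneg _) (hu i)
      calc ‖u i‖ ^ 2 * ((1 / (L : ℝ) ^ 2) * ∑ kv, Wk kv) ≤ 1 * (7 + κ ^ 2) :=
            mul_le_mul hu2 hWsum (mul_nonneg (by positivity) (sum_nonneg fun kv _ => hWk0 kv)) zero_le_one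
        _ = 7 + κ ^ 2 := one_mul _
    · simp only [heb]
      rw [norm_mul, Complex.norm_exp_ofReal_mul_I, mul_one, Complex.norm_real, Real.norm_eq_abs]
      simp
  -- (5) assemble
  have hdet := norm_det_truncatedPropagator_grid_add_symbol_le ξ hβ M r Ff Gf (fun a' => (Xu a').1.1.1) (fun b' => (Xb b').1.1.1)
  refine (congrArg (fun A : Matrix (Fin a) (Fin a) ℂ => ‖A.det‖) hmat).trans_le ?_
  rw [Matrix.det_transpose]
  refine hdet.trans ?_
  have h2 : ∀ j, Real.sqrt (2 * ∑ m, ‖Ff j m‖ ^ 2 * (7 + 1 / β * ∑ i', ‖r m i'‖)) ≤ Real.sqrt (2 * (7 + κ ^ 2)) := fun j =>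
    Real.sqrt_le_sqrt (by linarith [hFrow j])
  have h3 : ∀ i, Real.sqrt (2 * ∑ m, ‖Gf i m‖ ^ 2 * (7 + 1 / β * ∑ i', ‖r m i'‖)) ≤ Real.sqrt (2 * (7 + κ ^ 2)) := fun i =>
    Real.sqrt_le_sqrt (by linarith [hGrow i])
  calc (∏ a', Real.sqrt (2 * ∑ m, ‖Ff a' m‖ ^ 2 * (7 + 1 / β * ∑ i', ‖r m i'‖))) *
        ∏ b', Real.sqrt (2 * ∑ m, ‖Gf b' m‖ ^ 2 * (7 + 1 / β * ∑ i', ‖r m i'‖))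
      ≤ (∏ _a' : Fin a, Real.sqrt (2 * (7 + κ ^ 2))) * ∏ _b' : Fin a, Real.sqrt (2 * (7 + κ ^ 2)) :=
        mul_le_mul (prod_le_prod (fun _ _ => Real.sqrt_nonneg _) fun j _ => h2 j)
          (prod_le_prod (fun _ _ => Real.sqrt_nonneg _) fun i _ => h3 i) (prod_nonneg fun _ _ => Real.sqrt_nonneg _)
          (prod_nonneg fun _ _ => Real.sqrt_nonneg _)
    _ = Real.sqrt (2 * (7 + κ ^ 2)) ^ a * Real.sqrt (2 * (7 + κ ^ 2)) ^ a := by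
        rw [prod_const, card_univ, Fintype.card_fin]

/-- **The weighted normal covariance on the `4M` grid is replica-Gram-bounded with `√(2(7 + κ²))`** (the determinant bound and the
`U(1)` selection rule of the pulled-back normal covariance — the literal covariance hypothesis `IsGramBoundedR` of the Gram-bounded truncation
theorems `GrassmannEffectiveActionTruncationDB.*_of_gramBounded`). [cite: PedraSalmhofer2008, Thm 1.3] -/
theorem isGramBoundedR_gridSub_normalCovariance_weighted {β : ℝ} (hβ : 0 < β) (μ : ℝ) (K : TrigPolyC4v) [NeZero M]
    (v : FreqMomentum L M → ℝ) (hv1 : ∀ k, v k ≤ 1) {κ : ℝ}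
    (hIR : 1 / (β * (L : ℝ) ^ 2) * ∑ k : FreqMomentum L M,
        (1 - v k) / Real.sqrt (matsubaraFreq β M k.1 ^ 2 + nambuXiCT L μ K k.2 ^ 2) ≤ κ ^ 2) :
    IsGramBoundedR
      ((hubbardGridSub L M β (2 * (2 * M))).transpose *
        normalCovariance L M (fun ks => (v ks.1 : ℂ) *
          (((β * (L : ℝ) ^ 2 : ℝ) : ℂ) *
            ((Complex.I * matsubaraFreq β M ks.1.1 + nambuXiCT L μ K ks.1.2) / nambuDenCT L M β μ 0 K ks.1))) *
        hubbardGridSub L M β (2 * (2 * M)))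
      (Real.sqrt (2 * (7 + κ ^ 2))) :=
  (isDetBoundedR_gridSub_normalCovariance_weighted hβ μ K v hv1 hIR).isGramBoundedR
    (fun _ _ h => by
      simp only [hubbardGridSub]
      exact gridSub_pullback_normalCovariance_apply_of_charge_eq β _ _ _ (charge_eq_of_decide_eq_w h))
    (Real.sqrt_nonneg _)

end Main

end Literature.MathematicalPhysics.QuantumLattice

end
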